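import Summits.BirchSwinnertonDyer.BirchSwinnertonDyer.Theorems.SmallImageMuTransferMuTransferX9CoreAlgebra
import Summits.BirchSwinnertonDyer.BirchSwinnertonDyer.Theorems.OneSidedTwistSqueezeX9KatoDivisibilityX9ResidualWidth
import HarnessLib

set_option autoImplicit false

-- the summit and its single problem are both named `BirchSwinnertonDyer` (registry layout D-0017)
set_option linter.dupNamespace false

/-!
# Graded core, algebra: the COUNT WITH DEFECT (`C_0 = … = C_r = 0` from reciprocity for a unit multiple of
# `S^m`), low convolution coefficients are truncation-invariant, and the exact `p`-divisibility `s = p^d·s'`,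
# `s' ∉ p𝐇¹` of a class `s ∉ p^{n+1}𝐇¹` (graded Step 0 entry)

Seat `bsd-line-k6-p4` (prover-bsd-line-k6-p4-g4-0, 4th LEAD on crux stmt-BirchSwinnertonDyer-20547 `KatoDivisibilityX9`,
line `graded_euler_loss`).  THEOREMS ONLY, sorry-free, no definition, nothing asserted about any curve.
`--supports stmt-BirchSwinnertonDyer-20547`.  Pure-algebra service file for the GRADED port of the kernel core
(`CoreAssembly.coreOdd_of_selmerDual_of_stepsTwoFour`, cell `bsd-smallim`) to level `p^{n+1}` (MEMO-es §15/§25.2 of cell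
`bsd-f3-mu`; the depth stub `stub_depthCoreX9 : SIM.FineCoreGradedOddPrime` of the line of record):

* `convCoeff_aeval_left_eq_sum` — `C_j(U(S)·x, y) = Σ_{i ≤ j} U_i • C_{j−i}(x, y)` (`j < J`), the general form of
  the tree's `convCoeff_zero_aeval_left` / `convCoeff_one_aeval_left`;
* `convCoeff_eq_zero_of_reciprocity_le` — **the count with defect `r`**: if every convolution coefficient of index
  `i` with `i + ε < J` of `(U(S)·S^m k, c)` vanishes, `p ∤ U(0)`, `P` is `p`-torsion and `m + r + ε < J`, then
  `C_j(k, c) = 0` for all `j ≤ r` (the tree's `convCoeff_zero_one_eq_zero_of_reciprocity` is `r = 1`); this is what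
  the graded STEP 4 consumes when STEP 1 only guarantees a non-zero coefficient of index `≤ c₀ + 1` (Lemma 5.7.B WITH
  DEFECT, landed p614716);
* `convCoeff_eq_of_apply_castLE_eq` — coefficients of index `< J'` only see coordinates `< J'`: the pair of
  truncations to level `J'` has the same `C_j`, `j < J'` (the `rfl` bookkeeping `hk10/hk11/hcy0/hcy1` of the `n = 0`
  assembly, for every index);
* `shiftEnd_pow_eq_shiftEmbed_shiftEnd_pow_castLE_of_le`, `shiftH1_iterate_truncate_ne_zero_of_le` — truncation to
  ANY lower level `J' ≤ J` keeps the `T`-order: `T^k Ψ ≠ 0 ⟹ T^{k−(J−J')}(Ψ mod T^{J'}) ≠ 0` (the tree's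
  `shiftH1_iterate_truncate_ne_zero` is `J = 2e'+2, J' = e'+1`); needed because the level-`p^{d+1}` test class is
  taken at T6a-level `2e(d+1)` (so that it projects to the `ω²`-carrier: `T^{2e(d+1)} ∈ (p^{d+1}, ω²)`) and truncated
  to level `2e` for the mod-`p` count;
* `exists_eq_C_pow_smul_and_not_mem` — for a `Λ`-module `H` and `s ∉ p^{n+1}H`: `s = p^d·s'` with `d ≤ n` and
  `s' ∉ pH` (MEMO-es §25.2 (d) «hredᵍ is free»: the divided class `s'` carries the transverse VALUE, it is never used
  as an Euler system).

* (appended) `exists_one_add_pow_prime_pow_eq`, `pow_mem_span_prime_pow_omega_sq` — in any commutative ring,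
  `(1+x)^{p^N} = 1 + x^{p^N} + p·h` and `x^{2p^N(d+1)} ∈ (p^{d+1}, ((1+x)^{p^N} − 1)²)`: the `ω²`-PROJECTION by which the
  T6a-level-`2e(d+1)` test class of `stub_reciprocityPkX9` reaches the `ω²`-carrier `Λ/(p^{d+1}, ω²)` of MEMO-es §15.

References: B. Mazur, K. Rubin, Mem. AMS 799 (2004) Prop. 1.3.2, §4.4, §5.3 [MazurRubin2004]; L. Washington, GTM 83,
§13.1–13.2 [Washington1997]; HOME/MEMO-es.md §15 STEP 4, §25.2.
-/

noncomputable section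

open Literature.NumberTheory.GaloisRepresentations
open Literature.NumberTheory.EllipticCurves

namespace Summit.BirchSwinnertonDyer.BirchSwinnertonDyer.Theorems.OneSidedTwistSqueezeX9KatoDivisibilityX9GradedCoreAlgebra

open Summit.BirchSwinnertonDyer.BirchSwinnertonDyer.Rank1Residual.CoreAssembly

/-! ## §1 Convolution coefficients against `U(S)`: the general index -/

section Count

variable {M M' P : Type*} [AddCommGroup M] [AddCommGroup M'] [AddCommGroup P]
  (e : M →+ M' →+ P) {J : ℕ}

/-- `C_j(c • S^i x, y) = c • C_{j−i}(x, y)` for `i ≤ j < J`, and `0` for `j < i`. [cite: MazurRubin2004, §1.3 and §5.3] -/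
theorem convCoeff_zsmul_shiftEnd_pow_left (c : ℤ) (i : ℕ) {j : ℕ} (hj : j < J) (x : Fin J → M)
    (y : Fin J → M') :
    convCoeff e J j (c • (shiftEnd M J ^ i) x) y = if i ≤ j then c • convCoeff e J (j - i) x y else 0 := by
  have h1 : convCoeff e J j (c • (shiftEnd M J ^ i) x) y = c • convCoeff e J j ((shiftEnd M J ^ i) x) y :=
    map_zsmul ((convCoeffHom e J j).flip y) c _
  rw [h1, convCoeff_shiftEnd_pow_left_eq e i hj]
  split_ifs <;> simp

/-- **`C_j(U(S)·x, y) = Σ_{i ≤ j} U_i • C_{j−i}(x, y)`** for an integer polynomial `U` in the shift and `j < J`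
(linearity in `U` + the monomial case `convCoeff_zsmul_shiftEnd_pow_left`). [cite: MazurRubin2004, §1.3 and §5.3] -/
theorem convCoeff_aeval_left_eq_sum (U : Polynomial ℤ) {j : ℕ} (hj : j < J) (x : Fin J → M) (y : Fin J → M') :
    convCoeff e J j (Polynomial.aeval (shiftEnd M J) U x) y =
      ∑ i ∈ Finset.range (j + 1), U.coeff i • convCoeff e J (j - i) x y := by
  induction U using Polynomial.induction_on' with
  | add U V hU hV =>
    rw [map_add, LinearMap.add_apply, convCoeff_add_left, hU, hV, ← Finset.sum_add_distrib]
    refine Finset.sum_congr rfl fun i _ => ?_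
    rw [Polynomial.coeff_add, add_smul]
  | monomial i c =>
    rw [Polynomial.aeval_monomial, Module.End.mul_apply, Module.algebraMap_end_apply,
      convCoeff_zsmul_shiftEnd_pow_left e c i hj]
    simp only [Polynomial.coeff_monomial]
    by_cases hij : i ≤ j
    · rw [if_pos hij, Finset.sum_eq_single i]
      · simp
      · intro b _ hb
        rw [if_neg (Ne.symm hb), zero_smul]
      · intro hi
        exact absurd (Finset.mem_range.mpr (Nat.lt_succ_of_le hij)) hi
    · rw [if_neg hij]
      symm
      refine Finset.sum_eq_zero fun b hb => ?_
      have : i ≠ b := by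
        intro h
        subst h
        exact hij (Nat.lt_succ_iff.mp (Finset.mem_range.mp hb))
      rw [if_neg this, zero_smul]

/-- **The COUNT WITH DEFECT `r`**: if every convolution coefficient of index `i` with `i + ε < J` of
`(U(S)·S^m k, c)` vanishes, `U(0)` is prime to `p`, `P` is `p`-torsion and `m + r + ε < J`, then `C_j(k, c) = 0` for
every `j ≤ r` (triangular induction on `j`: `0 = C_{m+j}(U(S) S^m k, c) = Σ_{i ≤ j} U_i • C_{j−i}(k, c) = U_0 • C_j(k, c)`).
The tree's `convCoeff_zero_one_eq_zero_of_reciprocity` is the case `r = 1`. [cite: MazurRubin2004, Prop. 1.3.2, §4.4] -/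
theorem convCoeff_eq_zero_of_reciprocity_le {p : ℕ} (hp : p.Prime) (hP : ∀ c : P, (p : ℤ) • c = 0)
    {m r ε : ℕ} (hm : m + r + ε < J) (U : Polynomial ℤ) (hU : ¬ ((p : ℤ) ∣ U.coeff 0))
    (k : Fin J → M) (c : Fin J → M')
    (hrec : ∀ i : ℕ, i + ε < J →
      convCoeff e J i (Polynomial.aeval (shiftEnd M J) U ((shiftEnd M J ^ m) k)) c = 0) :
    ∀ j ≤ r, convCoeff e J j k c = 0 := by
  intro j hj
  induction j using Nat.strong_induction_on with
  | _ j ih =>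
    have hjJ : j < J := by omega
    have hr := hrec (m + j) (by omega)
    rw [aeval_shiftEnd_pow_apply, convCoeff_shiftEnd_pow_left_eq e _ (by omega), if_pos (by omega),
      show m + j - m = j by omega, convCoeff_aeval_left_eq_sum e U hjJ, Finset.sum_range_succ'] at hr
    have hzero : ∑ i ∈ Finset.range j, U.coeff (i + 1) • convCoeff e J (j - (i + 1)) k c = 0 := by
      refine Finset.sum_eq_zero fun i hi => ?_
      rw [ih (j - (i + 1)) (by simp at hi; omega) (by omega), smul_zero]
    rw [hzero, zero_add, Nat.sub_zero] at hr
    exact eq_zero_of_zsmul_eq_zero_of_not_dvd hp (hP _) hU hr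

/-- **Low coefficients are truncation-invariant**: if `x' i = x (castLE i)` and `y' i = y (castLE i)` for all
`i : Fin J'` (`J' ≤ J`), then `C_j(x', y') = C_j(x, y)` for every `j < J'`. [cite: MazurRubin2004, §1.3 and §5.3] -/
theorem convCoeff_eq_of_apply_castLE_eq {J' : ℕ} (hJ' : J' ≤ J) {j : ℕ} (hj : j < J')
    (x : Fin J → M) (y : Fin J → M') (x' : Fin J' → M) (y' : Fin J' → M')
    (hx : ∀ i : Fin J', x' i = x (Fin.castLE hJ' i)) (hy : ∀ i : Fin J', y' i = y (Fin.castLE hJ' i)) :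
    convCoeff e J' j x' y' = convCoeff e J j x y := by
  rw [convCoeff_def, convCoeff_def]
  refine Finset.sum_congr rfl fun a ha => ?_
  have haj : a ≤ j := Nat.lt_succ_iff.mp (Finset.mem_range.mp ha)
  rw [coeffFun_of_lt x' (show a < J' by omega), coeffFun_of_lt x (show a < J by omega),
    coeffFun_of_lt y' (show j - a < J' by omega), coeffFun_of_lt y (show j - a < J by omega), hx, hy]
  rfl

end Count

/-! ## §2 Graded Step 0 entry: exact `p`-divisibility of a class `s ∉ p^{n+1}H` -/

section Divisibility

open IwasawaAlgebra

variable {p : ℕ} [Fact p.Prime] {H : Type*} [AddCommGroup H] [Module (IwasawaAlgebra p) H]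

/-- **`s ∉ p^{n+1}H ⟹ s = p^d·s'` with `d ≤ n` and `s' ∉ pH`** (`d` = the exact `p`-divisibility of `s`;
elementary: `(p)^d • ⊤ = p^d • ⊤` pointwise, no freeness of `H` used). [cite: Washington1997, §13.1–§13.2] -/
theorem exists_eq_C_pow_smul_and_not_mem {n : ℕ} {s : H}
    (hs : s ∉ (augIdealP p ^ (n + 1)) • (⊤ : Submodule (IwasawaAlgebra p) H)) :
    ∃ d ≤ n, ∃ s' : H, s = (PowerSeries.C (p : ℤ_[p]) : IwasawaAlgebra p) ^ d • s' ∧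
      s' ∉ augIdealP p • (⊤ : Submodule (IwasawaAlgebra p) H) := by
  classical
  -- the least `d` with `s ∉ (p)^{d+1} H`
  have hex : ∃ d, s ∉ (augIdealP p ^ (d + 1)) • (⊤ : Submodule (IwasawaAlgebra p) H) := ⟨n, hs⟩
  let d := Nat.find hex
  have hd : s ∉ (augIdealP p ^ (d + 1)) • (⊤ : Submodule (IwasawaAlgebra p) H) := Nat.find_spec hex
  have hdn : d ≤ n := Nat.find_min' hex hs
  have hmem : s ∈ (augIdealP p ^ d) • (⊤ : Submodule (IwasawaAlgebra p) H) := by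
    rcases Nat.eq_zero_or_pos d with h0 | hpos
    · rw [h0, pow_zero, Ideal.one_eq_top, Submodule.top_smul]
      exact Submodule.mem_top
    · obtain ⟨d', hd'⟩ : ∃ d', d = d' + 1 := ⟨d - 1, by omega⟩
      have hmin := Nat.find_min hex (show d' < d by omega)
      push Not at hmin
      rw [hd']
      exact hmin
  refine ⟨d, hdn, ?_⟩
  -- `s = p^d • s'`
  have hmem' := hmem
  rw [augIdealP, Ideal.span_singleton_pow, Submodule.ideal_span_singleton_smul] at hmem'
  obtain ⟨s', -, hs'eq⟩ := (Submodule.mem_smul_pointwise_iff_exists _ _ _).mp hmem'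
  refine ⟨s', hs'eq.symm, fun hs' => hd ?_⟩
  -- `s' ∈ pH ⟹ p^d s' ∈ p^{d+1} H`
  rw [← hs'eq, pow_succ, Submodule.mul_smul, augIdealP, Ideal.span_singleton_pow,
    Submodule.ideal_span_singleton_smul]
  exact Submodule.smul_mem_pointwise_smul _ _ _ hs'

end Divisibility

/-! ## §3 Truncation keeps the `T`-order (general levels) -/

section TruncGeneral

variable {M : Type*} [AddCommGroup M]

/-- `S_J^k x = T^{J−J'}·(S_{J'}^{k−(J−J')}(x mod T^{J'}))` on `Fin J → M`, for `J' ≤ J` and `J − J' ≤ k`: the shift by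
`k` factors through truncation to level `J'`, the shift by `k − (J − J')` there, and the `T^{J−J'}`-embedding
(the tree's `shiftEnd_pow_eq_shiftEmbed_shiftEnd_pow_castLE` is `J = 2e'+2`, `J' = e'+1`, `k = 2e'+1`).
[cite: Washington1997, §13.1–§13.2] -/
theorem shiftEnd_pow_eq_shiftEmbed_shiftEnd_pow_castLE_of_le {J J' : ℕ} (h : J' ≤ J) {k : ℕ}
    (hk : J - J' ≤ k) (x : Fin J → M) :
    (shiftEnd M J ^ k) x =
      ZpExtension.shiftEmbed J h ((shiftEnd M J' ^ (k - (J - J'))) (fun i => x (Fin.castLE h i))) := by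
  funext i
  simp only [shiftEnd_pow_apply, ZpExtension.shiftEmbed_apply]
  by_cases h1 : (i : ℕ) < k
  · rw [dif_pos h1]
    by_cases h2 : J - J' ≤ (i : ℕ)
    · rw [dif_pos h2, dif_pos (by omega)]
    · rw [dif_neg h2]
  · rw [dif_neg h1, dif_pos (by omega), dif_neg (by simp; omega)]
    congr 1
    ext
    simp only [Fin.val_castLE]
    omega

end TruncGeneral

section TruncH1

variable {p : ℕ} [Fact p.Prime] (κ₁ : ZpExtension ℚ p) {M : Type} [AddCommGroup M]
  [TopologicalSpace M] [DiscreteTopology M] (ρ : DiscreteGaloisModule ℚ M) (hM : ∀ x : M, p • x = 0)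

/-- **Truncation keeps the `T`-order, general levels**: if `T^k Ψ ≠ 0` in `H¹(K, 𝒯_J)` and `J − J' ≤ k`
(`J' ≤ J`), then the truncation `ψ` of `Ψ` to level `J'` has `T^{k−(J−J')} ψ ≠ 0` (the tree's
`shiftH1_iterate_truncate_ne_zero` is the case `J = 2e'+2`, `J' = e'+1`, `k = 2e'+1`).
[cite: Washington1997, §13.1–§13.2] [cite: MazurRubin2004, §5.3] -/
theorem shiftH1_iterate_truncate_ne_zero_of_le {J J' : ℕ} (h : J' ≤ J) {k : ℕ} (hk : J - J' ≤ k)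
    (Ψc : contOneCocycles (κ₁.twistModP ρ hM J).toTopRep)
    (hΨT : (κ₁.shiftH1 ρ hM J)^[k] (oneCocycleClass (κ₁.twistModP ρ hM J).toTopRep Ψc) ≠ 0) :
    (κ₁.shiftH1 ρ hM J')^[k - (J - J')]
      (oneCocycleClass (κ₁.twistModP ρ hM J').toTopRep
        (κ₁.pushCocycle ρ hM J (κ₁.twistModPTruncate ρ hM J h) Ψc)) ≠ 0 := by
  intro h0
  apply hΨT
  set ψ := κ₁.pushCocycle ρ hM J (κ₁.twistModPTruncate ρ hM J h) Ψc with hψdef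
  have h0' : (oneCocycleClass (κ₁.twistModP ρ hM J').toTopRep
      (κ₁.shiftPowCocycle ρ hM J' (k - (J - J')) ψ) : galoisCohomology (κ₁.twistModP ρ hM J') 1) = 0 :=
    (ZpExtension.shiftH1_iterate_oneCocycleClass κ₁ ρ hM J' (k - (J - J')) ψ).symm.trans h0
  have h1 : galoisCohomology.map (κ₁.twistModPShiftEmbed ρ hM J h) 1
      (oneCocycleClass (κ₁.twistModP ρ hM J').toTopRep (κ₁.shiftPowCocycle ρ hM J' (k - (J - J')) ψ)) = 0 := by
    rw [h0']
    exact map_zero _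
  rw [ZpExtension.map_oneCocycleClass_twist] at h1
  have h2 : κ₁.shiftPowCocycle ρ hM J k Ψc =
      κ₁.pushCocycle ρ hM J' (κ₁.twistModPShiftEmbed ρ hM J h)
        (κ₁.shiftPowCocycle ρ hM J' (k - (J - J')) ψ) :=
    Subtype.ext (ContinuousMap.ext fun σ =>
      shiftEnd_pow_eq_shiftEmbed_shiftEnd_pow_castLE_of_le h hk (Ψc.1 σ))
  have h3 : oneCocycleClass (κ₁.twistModP ρ hM J).toTopRep (κ₁.shiftPowCocycle ρ hM J k Ψc) = 0 := by
    rw [h2]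
    exact h1
  exact (ZpExtension.shiftH1_iterate_oneCocycleClass κ₁ ρ hM J k Ψc).trans h3

end TruncH1

/-! ## §4 The `ω²`-projection: `T^{2e(d+1)} ∈ (p^{d+1}, ω²)` for `e = p^N`, `ω = (1+T)^e − 1` (appended, g4) -/

section OmegaSq

variable {R : Type*} [CommRing R]

/-- In any commutative ring: `(1 + x)^{p^N} = 1 + x^{p^N} + p·h` for some `h` (freshman's dream modulo `p`; reduce to
`R/(p)` where it is the tree's `one_add_pow_prime_pow_of_natCast_eq_zero`). [cite: Washington1997, §13.2 (arithmetic in Λ/(p, T^n))] -/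
theorem exists_one_add_pow_prime_pow_eq {p : ℕ} (hp : p.Prime) (x : R) (N : ℕ) :
    ∃ h : R, (1 + x) ^ p ^ N = 1 + x ^ p ^ N + (p : R) * h := by
  have hq : (Ideal.Quotient.mk (Ideal.span {(p : R)}) ((1 + x) ^ p ^ N) =
      Ideal.Quotient.mk (Ideal.span {(p : R)}) (1 + x ^ p ^ N)) := by
    rw [map_pow, map_add, map_one, map_add, map_one, map_pow]
    exact one_add_pow_prime_pow_of_natCast_eq_zero hp
      (by rw [← map_natCast (Ideal.Quotient.mk (Ideal.span {(p : R)})), Ideal.Quotient.eq_zero_iff_mem]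
          exact Ideal.mem_span_singleton_self _) _ N
  rw [Ideal.Quotient.eq, Ideal.mem_span_singleton'] at hq
  obtain ⟨h, hh⟩ := hq
  exact ⟨h, by linear_combination (-1 : R) * hh⟩

/-- **The `ω²`-projection**: with `e = p^N` and `ω = (1+x)^e − 1` one has `x^{2e} ≡ ω²  (mod p)`, hence
`x^{2e(d+1)} ∈ (p^{d+1}, ω²)` — so the level-`(p^{d+1}, T^{2e(d+1)})` carrier of T-es-6 (a) maps onto the `ω²`-carrier
`Λ/(p^{d+1}, ω²)` of MEMO-es §15 (the test class of `stub_reciprocityPkX9` is handed over at T6a-level `2e(d+1)` for this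
reason).  Pure ring identity, any commutative ring. [cite: Washington1997, §13.2 (arithmetic in Λ/(p, T^n))] -/
theorem pow_mem_span_prime_pow_omega_sq {p : ℕ} (hp : p.Prime) (x : R) (N d : ℕ) :
    x ^ (2 * p ^ N * (d + 1)) ∈ Ideal.span {((p : R) ^ (d + 1)), ((1 + x) ^ p ^ N - 1) ^ 2} := by
  obtain ⟨h, hh⟩ := exists_one_add_pow_prime_pow_eq hp x N
  set ω : R := (1 + x) ^ p ^ N - 1 with hω
  -- `x^e = ω − p h`, so `x^{2e} = ω² + p h'`
  have hxe : x ^ p ^ N = ω - (p : R) * h := by rw [hω, hh]; ring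
  have hx2e : x ^ (2 * p ^ N) = ω ^ 2 + (p : R) * (-(2 * ω * h) + (p : R) * h ^ 2) := by
    rw [pow_mul, ← pow_mul, mul_comm 2, pow_mul, hxe]; ring
  -- in `R/(p^{d+1}, ω²)` the element `x^{2e}` is `p·h'`, whose `(d+1)`-st power vanishes
  rw [← Ideal.Quotient.eq_zero_iff_mem, pow_mul, map_pow, hx2e, map_add, map_pow]
  have hω0 : Ideal.Quotient.mk (Ideal.span {((p : R) ^ (d + 1)), ω ^ 2}) ω ^ 2 = 0 := by
    rw [← map_pow, Ideal.Quotient.eq_zero_iff_mem]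
    exact Ideal.subset_span (by simp)
  have hp0 : Ideal.Quotient.mk (Ideal.span {((p : R) ^ (d + 1)), ω ^ 2}) (p : R) ^ (d + 1) = 0 := by
    rw [← map_pow, Ideal.Quotient.eq_zero_iff_mem]
    exact Ideal.subset_span (by simp)
  rw [hω0, zero_add, map_mul, mul_pow, hp0, zero_mul]

end OmegaSq

end Summit.BirchSwinnertonDyer.BirchSwinnertonDyer.Theorems.OneSidedTwistSqueezeX9KatoDivisibilityX9GradedCoreAlgebra

end
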